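/-
Copyright (c) 2026. All rights reserved.
Released under Apache 2.0 license as described in the file LICENSE.
Authors: abc-iut cell, prover seat abc-iut-L4-t5 (gen 10; row «F3757-PORT», abc-iut-L4-lead m147 (5)), over abc-iut-f-101's
`DiagramPathEmbeddings.lean` / `DiagramSinkSystems.lean` and files 1–3 of this mover.
-/
import Literature.AnabelianGeometry.AbsoluteAnabelian.LogFrobeniusAnTelecoreSinkPairs
import HarnessLib

/-!
# [AbsTopIII] Cor 5.5 (iii), last sentence, inside `D_{An•}`: the sink pre-family of an observable read in the telecore diagram

S. Mochizuki, *Topics in absolute anabelian geometry III: global reconstruction algorithms*,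
J. Math. Sci. Univ. Tokyo 22 (2015) 939–1156 [MochizukiAbsTopIII2015]; manuscript `paper:url-5493eb38cbb7`, locators read on the
page: Def 3.5 (ii) p. 75 (families of homotopies; "compatible"), (iii) p. 75 (observables), (iv) p. 76 (telecores), Cor 5.5 (ii)
p. 130 (`𝔗_{An•}`), (iii) p. 131 ("the families of homotopies that constitute `S_log` and `S_log⊞` are compatible with one another as
well as with the families of homotopies that constitute the core and telecore structures of (i), (ii)"), Rmk 3.5.1 p. 78.

WHAT (row «F3757-PORT», file 4 of the mover).  The member pairs AT the observation vertex `x` of a sub-observable of `D_{An•}` (the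
shape `embObs` of file 1, a family `H` on the pulled-back presentation) in the sense of abc-iut-f-101's `SinkSystem`: INNER pairs
(abc-iut-f-101's `LiftPair`, source a base vertex) OR OUTER pairs (file 3's `OuterDec`) — `SinkDec` — with ONE homotopy per pair
(`SinkDec.hom_eq`: the two presentations exclude each other and each is unique, files 2–3), and the three sink laws at `x`:

* `sinkη_self` (identity on the diagonal), `anSink_trans` (composition; inner∘inner by abc-iut-f-101's `lift_trans`, outer∘outer by
  file 3's `hom_trans`, mixed impossible), `anSink_precomp` (pre-whiskering by ANY path of `D_{An•}`: file 2's inner-or-outer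
  dichotomy for the pre-composing path — an inner pair pre-composed with a path through `An•[𝒳]` becomes outer);
* `isOver_anSinkη` — every member homotopy lies over `Th•[Z]` (file 1's `anOverE`), given `hover` for the observable's own homotopies;
* `sink_push_of_isOver` — **push-forward INTO `x` through `An•[𝒳]`**: any pair `(γ₁, γ₂)` of `D_{An•}` with an OVER-homotopy `θ`,
  post-composed with `s₁ ; φ_⋏ ; u` (`s₁` into `An•[𝒳]`, `u` an observable path with `(u, u)` a member), is a member at `x` whose
  homotopy is `θ ▹ D_[s₁ ; φ_⋏ ; u]` (the lift of `(γ₁ ; s₁, γ₂ ; s₁)` at `An•[𝒳]` IS `θ ▹ D_[s₁]`, Rmk 3.5.1).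

Pure category theory; nothing here bears on [IUTchIII] Cor. 3.12; no side taken.
-/

set_option autoImplicit false

universe u

open CategoryTheory Quiver

namespace Literature.AnabelianGeometry.AbsoluteAnabelian

namespace LogFrobeniusSetting

open DiagramOfCategories

variable {Vmod : Type u} {isArc : Vmod → Bool} (L : LogFrobeniusSetting Vmod isArc)

section Sink

variable (P : DVertex Vmod isArc → Prop) (xs : DVertex Vmod isArc) (hP : ∀ ⦃a : DVertex Vmod isArc⦄, P a → InFive (isArc := isArc) a)
  (hxs : InFive (isArc := isArc) xs)
  (H : (L.anDiagram.comapAlong (embObs P xs hP hxs)).HomotopyFamily)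

/-! ## Members at the observation vertex: inner or outer -/

/-- **An inner pair**: a lifting pair (abc-iut-f-101) whose source is a BASE vertex of the observable's diagram (the trivial pairs at
the observation vertex itself are left to the generated family, as in abc-iut-f-101's `plusSinkE`).
[cite: MochizukiAbsTopIII2015, Cor 5.5 (iii) p. 131] -/
structure InnerDec {x : (anShape (Vmod := Vmod) (isArc := isArc)).Vertex}
    (Pth Qth : Path x ((embObs P xs hP hxs).obj (obsShape P xs).obs)) : Type (u + 1) where
  /-- the lifting pair -/
  w : LiftPair (embObs P xs hP hxs) L.anDiagram (obsShape P xs).obs H Pth Qth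
  src_ne : w.src ≠ (obsShape P xs).obs

/-- **A member presentation** at the observation vertex: inner or outer. [cite: MochizukiAbsTopIII2015, Cor 5.5 (iii) p. 131] -/
def SinkDec {x : (anShape (Vmod := Vmod) (isArc := isArc)).Vertex} (Pth Qth : Path x ((embObs P xs hP hxs).obj (obsShape P xs).obs)) :
    Type (u + 1) :=
  L.InnerDec P xs hP hxs H Pth Qth ⊕ OuterDec L P xs hP hxs H Pth Qth

variable {L P xs hP hxs H}

/-- The homotopy of a member presentation. [cite: MochizukiAbsTopIII2015, Definition 3.5 (ii) p.75] -/
noncomputable def SinkDec.hom {x : (anShape (Vmod := Vmod) (isArc := isArc)).Vertex}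
    {Pth Qth : Path x ((embObs P xs hP hxs).obj (obsShape P xs).obs)} :
    L.SinkDec P xs hP hxs H Pth Qth → (L.anDiagram.pathFunctor Pth ⟶ L.anDiagram.pathFunctor Qth)
  | Sum.inl d => d.w.hom
  | Sum.inr d => d.hom

/-- **One homotopy per member pair**: two presentations of the same pair have the same homotopy (inner and outer exclude each
other, file 2; each is unique, abc-iut-f-101's `LiftPair.subsingleton'` / file 3's `OuterDec.subsingleton`).
[cite: MochizukiAbsTopIII2015, Definition 3.5 (ii) p.75] -/
theorem SinkDec.hom_eq (hnot : ¬ P xs) {x : (anShape (Vmod := Vmod) (isArc := isArc)).Vertex}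
    {Pth Qth : Path x ((embObs P xs hP hxs).obj (obsShape P xs).obs)} (d d' : L.SinkDec P xs hP hxs H Pth Qth) : d.hom = d'.hom := by
  have hF := graphEmbedding_embObs P xs hP hxs hnot
  rcases d with ⟨w, hw⟩ | d <;> rcases d' with ⟨w', hw'⟩ | d'
  · simp only [SinkDec.hom, LiftPair.subsingleton' hF w w']
  · exact absurd (w.left_heq.trans (heq_of_eq d'.left_eq)) (inner_ne_outer P xs hP hxs w.left w.src_eq d'.a d'.j d'.u)
  · exact absurd (w'.left_heq.trans (heq_of_eq d.left_eq)) (inner_ne_outer P xs hP hxs w'.left w'.src_eq d.a d.j d.u)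
  · simp only [SinkDec.hom, OuterDec.subsingleton hnot d d']

variable (L P xs hP hxs H)

/-- The member pairs at the observation vertex. [cite: MochizukiAbsTopIII2015, Cor 5.5 (iii) p. 131] -/
def sinkE {x : (anShape (Vmod := Vmod) (isArc := isArc)).Vertex} (Pth Qth : Path x ((embObs P xs hP hxs).obj (obsShape P xs).obs)) :
    Prop :=
  Nonempty (L.SinkDec P xs hP hxs H Pth Qth)

/-- Their homotopies. [cite: MochizukiAbsTopIII2015, Definition 3.5 (ii) p.75] -/
noncomputable def sinkη {x : (anShape (Vmod := Vmod) (isArc := isArc)).Vertex}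
    {Pth Qth : Path x ((embObs P xs hP hxs).obj (obsShape P xs).obs)} (h : L.sinkE P xs hP hxs H Pth Qth) :
    L.anDiagram.pathFunctor Pth ⟶ L.anDiagram.pathFunctor Qth :=
  (Classical.choice h).hom

variable {L P xs hP hxs H}

/-- The homotopy is computed by ANY presentation. [cite: MochizukiAbsTopIII2015, Definition 3.5 (ii) p.75] -/
theorem sinkη_eq (hnot : ¬ P xs) {x : (anShape (Vmod := Vmod) (isArc := isArc)).Vertex}
    {Pth Qth : Path x ((embObs P xs hP hxs).obj (obsShape P xs).obs)} (h : L.sinkE P xs hP hxs H Pth Qth)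
    (d : L.SinkDec P xs hP hxs H Pth Qth) : L.sinkη P xs hP hxs H h = d.hom :=
  SinkDec.hom_eq hnot _ d

/-- An observable pair from a base vertex is an (inner) member with the observable's homotopy read in `D_{An•}`.
[cite: MochizukiAbsTopIII2015, Cor 5.5 (iii) p. 131] -/
theorem sinkη_ofMem (hnot : ¬ P xs) (c : DSub P) {p q : Path ((obsShape P xs).base c) (obsShape P xs).obs} (m : H.E p q) :
    ∃ h : L.sinkE P xs hP hxs H ((embObs P xs hP hxs).mapPath p) ((embObs P xs hP hxs).mapPath q),
      L.sinkη P xs hP hxs H h = (LiftPair.ofMem (F := embObs P xs hP hxs) (D := L.anDiagram) m).hom :=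
  ⟨⟨Sum.inl ⟨LiftPair.ofMem m, fun h => by cases h⟩⟩, sinkη_eq hnot _ (Sum.inl ⟨LiftPair.ofMem m, fun h => by cases h⟩)⟩

/-! ## The sink laws at the observation vertex -/

/-- **Identity on the diagonal.** [cite: MochizukiAbsTopIII2015, Definition 3.5 (ii) p.75] -/
theorem sinkη_self (hnot : ¬ P xs) {x : (anShape (Vmod := Vmod) (isArc := isArc)).Vertex}
    {Pth : Path x ((embObs P xs hP hxs).obj (obsShape P xs).obs)} (h : L.sinkE P xs hP hxs H Pth Pth) :
    L.sinkη P xs hP hxs H h = 𝟙 _ := by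
  obtain ⟨d⟩ := h
  rw [sinkη_eq hnot _ d]
  rcases d with ⟨w, hw⟩ | d
  · change w.hom = 𝟙 _
    rw [← liftη_eq (graphEmbedding_embObs P xs hP hxs hnot) ⟨w⟩ w]
    exact liftη_self (graphEmbedding_embObs P xs hP hxs hnot) _
  · exact d.hom_self hnot

/-- **Composition.** [cite: MochizukiAbsTopIII2015, Definition 3.5 (ii) p.75] -/
theorem anSink_trans (hnot : ¬ P xs) {x : (anShape (Vmod := Vmod) (isArc := isArc)).Vertex}
    {Pth Qth Rth : Path x ((embObs P xs hP hxs).obj (obsShape P xs).obs)} (h₁ : L.sinkE P xs hP hxs H Pth Qth)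
    (h₂ : L.sinkE P xs hP hxs H Qth Rth) :
    ∃ h₃ : L.sinkE P xs hP hxs H Pth Rth,
      L.sinkη P xs hP hxs H h₃ = L.sinkη P xs hP hxs H h₁ ≫ L.sinkη P xs hP hxs H h₂ := by
  have hF := graphEmbedding_embObs P xs hP hxs hnot
  obtain ⟨d₁⟩ := h₁
  obtain ⟨d₂⟩ := h₂
  rw [sinkη_eq hnot _ d₁, sinkη_eq hnot _ d₂]
  rcases d₁ with ⟨w₁, hw₁⟩ | d₁ <;> rcases d₂ with ⟨w₂, hw₂⟩ | d₂
  · obtain ⟨h₃, e⟩ := lift_trans hF ⟨w₁⟩ ⟨w₂⟩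
    obtain ⟨w₃⟩ := h₃
    have hs : w₃.src = w₁.src := hF.obj_injective (w₃.src_eq.trans w₁.src_eq.symm)
    have hw₃ : w₃.src ≠ (obsShape P xs).obs := fun h3 => hw₁ (hs ▸ h3)
    refine ⟨⟨Sum.inl ⟨w₃, hw₃⟩⟩, ?_⟩
    rw [sinkη_eq hnot _ (Sum.inl ⟨w₃, hw₃⟩)]
    change w₃.hom = w₁.hom ≫ w₂.hom
    rw [← liftη_eq hF ⟨w₃⟩ w₃, ← liftη_eq hF ⟨w₁⟩ w₁, ← liftη_eq hF ⟨w₂⟩ w₂]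
    exact e
  · exact absurd (w₁.right_heq.trans (heq_of_eq d₂.left_eq)) (inner_ne_outer P xs hP hxs w₁.right w₁.src_eq d₂.a d₂.j d₂.u)
  · exact absurd (w₂.left_heq.trans (heq_of_eq d₁.right_eq)) (inner_ne_outer P xs hP hxs w₂.left w₂.src_eq d₁.b d₁.j d₁.u')
  · obtain ⟨d₃, e⟩ := d₁.hom_trans hnot d₂
    exact ⟨⟨Sum.inr d₃⟩, (sinkη_eq hnot _ (Sum.inr d₃)).trans e⟩

variable (hcl : ∀ ⦃y : DVertex Vmod isArc⦄ ⦃c : DVertex Vmod isArc⦄, DEdge isArc y c → InFive (isArc := isArc) y → (P c ∨ c = xs) → P y)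
  (hxsJ : ∀ j : TelecoreIdx (Vmod := Vmod) (isArc := isArc) xs, False)

include hcl hxsJ in
/-- **Pre-whiskering by ANY path of `D_{An•}`.**  For an inner pair the pre-composing path is inner (lift it: abc-iut-f-101's law
without a sieve, `liftη_precomp_mapPath`) or outer (the pair becomes OUTER with equal heads); for an outer pair the heads absorb it.
[cite: MochizukiAbsTopIII2015, Definition 3.5 (ii) p.75] -/
theorem anSink_precomp (hnot : ¬ P xs) {x' x : (anShape (Vmod := Vmod) (isArc := isArc)).Vertex}
    {Pth Qth : Path x ((embObs P xs hP hxs).obj (obsShape P xs).obs)} (h : L.sinkE P xs hP hxs H Pth Qth) (r : Path x' x) :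
    ∃ h' : L.sinkE P xs hP hxs H (r.comp Pth) (r.comp Qth), ∀ x₀ : L.anDiagram.obj x',
      (L.sinkη P xs hP hxs H h').app x₀ = eqToHom (L.anDiagram.pathFunctor_comp_obj r Pth x₀) ≫
        (L.sinkη P xs hP hxs H h).app ((L.anDiagram.pathFunctor r).obj x₀) ≫ eqToHom (L.anDiagram.pathFunctor_comp_obj r Qth x₀).symm := by
  have hF := graphEmbedding_embObs P xs hP hxs hnot
  obtain ⟨d⟩ := h
  rw [sinkη_eq hnot _ d]
  rcases d with ⟨w, hw⟩ | d
  · obtain ⟨src, left, right, mem, hs, hl, hq⟩ := w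
    rcases src with c | _
    swap
    · exact (hw rfl).elim
    subst hs
    cases hl; cases hq
    rcases exists_inner_or_outer' P xs hP hxs hcl hxsJ ((obsShape P xs).base c) r with ⟨a₀, r₀, ha₀, hr⟩ | ⟨a, c', hc', j, r₁, hr⟩
    · -- `r` is an included path: lift it
      subst ha₀
      cases hr
      rcases a₀ with a₀ | _
      swap
      · exact (path_obs_base_elim P xs c r₀).elim
      obtain ⟨h', e⟩ := liftη_precomp_mapPath L.anDiagram H hF ⟨LiftPair.ofMem mem⟩ r₀
      obtain ⟨w'⟩ := h'
      have hsrc : w'.src ≠ (obsShape P xs).obs := by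
        intro hs
        have h1 : w'.src = (obsShape P xs).base a₀ := hF.obj_injective w'.src_eq
        rw [hs] at h1
        cases h1
      refine ⟨⟨Sum.inl ⟨w', hsrc⟩⟩, fun x₀ => ?_⟩
      refine (NatTrans.congr_app (sinkη_eq hnot _ (Sum.inl ⟨w', hsrc⟩)) x₀).trans ?_
      change w'.hom.app x₀ = _
      rw [← liftη_eq hF ⟨w'⟩ w', e x₀, liftη_eq hF _ (LiftPair.ofMem mem)]
      rfl
    · -- `r` passes through `An•[𝒳]`: the pair becomes outer, with equal heads
      subst hr
      have mem' : H.E (r₁.comp left) (r₁.comp right) := H.isSaturated.precomp (H.isSaturated.postcomp mem Path.nil) r₁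
      have hl : ((a.cons j).comp ((embObs P xs hP hxs).mapPath r₁)).comp ((embObs P xs hP hxs).mapPath left) =
          (a.comp (edgePath j)).comp ((embObs P xs hP hxs).mapPath (r₁.comp left)) := by
        rw [OuterDec.comp_edgePath_comp, Prefunctor.mapPath_comp]; exact Path.comp_assoc _ _ _
      have hq : ((a.cons j).comp ((embObs P xs hP hxs).mapPath r₁)).comp ((embObs P xs hP hxs).mapPath right) =
          (a.comp (edgePath j)).comp ((embObs P xs hP hxs).mapPath (r₁.comp right)) := by
        rw [OuterDec.comp_edgePath_comp, Prefunctor.mapPath_comp]; exact Path.comp_assoc _ _ _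
      -- the observable part on the composite paths: abc-iut-f-101's law without a sieve
      obtain ⟨h₁, e₁⟩ := liftη_precomp_mapPath L.anDiagram H hF ⟨LiftPair.ofMem mem⟩ r₁
      let w₁ : LiftPair (embObs P xs hP hxs) L.anDiagram (obsShape P xs).obs H
          (((embObs P xs hP hxs).mapPath r₁).comp ((embObs P xs hP hxs).mapPath left))
          (((embObs P xs hP hxs).mapPath r₁).comp ((embObs P xs hP hxs).mapPath right)) :=
        ⟨(obsShape P xs).base ⟨c', hc'⟩, r₁.comp left, r₁.comp right, mem', rfl, heq_of_eq (Prefunctor.mapPath_comp _ _ _),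
          heq_of_eq (Prefunctor.mapPath_comp _ _ _)⟩
      have hp₁ := congrArg L.anDiagram.pathFunctor (Prefunctor.mapPath_comp (embObs P xs hP hxs) r₁ left)
      have hp₂ := congrArg L.anDiagram.pathFunctor (Prefunctor.mapPath_comp (embObs P xs hP hxs) r₁ right)
      have e₃ : w₁.hom = liftη (embObs P xs hP hxs) L.anDiagram (obsShape P xs).obs H h₁ := (liftη_eq hF h₁ w₁).symm
      have e₂ : (LiftPair.ofMem (F := embObs P xs hP hxs) (D := L.anDiagram) mem').hom =
          eqToHom hp₁ ≫ liftη (embObs P xs hP hxs) L.anDiagram (obsShape P xs).obs H h₁ ≫ eqToHom hp₂.symm := by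
        refine Eq.trans ?_ (congrArg (fun t => eqToHom hp₁ ≫ t ≫ eqToHom hp₂.symm) e₃)
        rw [show w₁.hom = _ from
          L.anDiagram.transportHom_eq (Prefunctor.mapPath_comp _ r₁ left) (Prefunctor.mapPath_comp _ r₁ right) _, ← LiftPair.hom_ofMem]
        simp
      -- the outer member and its homotopy at the level of natural transformations
      have hd : (⟨a, a, c', hc', j, r₁.comp left, r₁.comp right, mem', hl, hq⟩ : OuterDec L P xs hP hxs H _ _).hom =
          eqToHom (L.anDiagram.pathFunctor_eq_of_eq_comp _ _ hl) ≫
            Functor.whiskerLeft (L.anDiagram.pathFunctor (a.comp (edgePath j)))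
              (eqToHom hp₁ ≫ liftη (embObs P xs hP hxs) L.anDiagram (obsShape P xs).obs H h₁ ≫ eqToHom hp₂.symm) ≫
            eqToHom (L.anDiagram.pathFunctor_eq_of_eq_comp _ _ hq).symm := by
        rw [OuterDec.hom, OuterDec.tailHom]
        dsimp only
        rw [headHom_self, e₂]
        exact outerShape_head_id _ (L.anDiagram.pathFunctor_eq_of_eq_comp _ _ hl) (L.anDiagram.pathFunctor_eq_of_eq_comp _ _ hq)
      refine ⟨⟨Sum.inr ⟨a, a, c', hc', j, r₁.comp left, r₁.comp right, mem', hl, hq⟩⟩, fun x₀ => ?_⟩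
      refine (NatTrans.congr_app (sinkη_eq hnot _ (Sum.inr ⟨a, a, c', hc', j, r₁.comp left, r₁.comp right, mem', hl, hq⟩)) x₀).trans ?_
      refine (NatTrans.congr_app hd x₀).trans ?_
      refine (app_conj_whiskerLeft (L.anDiagram.pathFunctor (a.comp (edgePath j))) _
        (L.anDiagram.pathFunctor_eq_of_eq_comp _ _ hl) (L.anDiagram.pathFunctor_eq_of_eq_comp _ _ hq) x₀
        (L.anDiagram.pathFunctor_obj_of_eq_comp _ _ hl x₀) (L.anDiagram.pathFunctor_obj_of_eq_comp _ _ hq x₀).symm).trans ?_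
      simp only [NatTrans.comp_app, eqToHom_app]
      erw [e₁, liftη_eq hF _ (LiftPair.ofMem mem)]
      exact conj₃_app_congr (LiftPair.ofMem (F := embObs P xs hP hxs) (D := L.anDiagram) mem).hom
        (L.anDiagram.pathFunctor_comp_obj (a.cons j) ((embObs P xs hP hxs).mapPath r₁) x₀).symm _ _ _ _ _ _ _ _
  · obtain ⟨d', e⟩ := d.hom_precomp r
    refine ⟨⟨Sum.inr d'⟩, fun x₀ => ?_⟩
    refine (NatTrans.congr_app (sinkη_eq hnot _ (Sum.inr d')) x₀).trans ?_
    change d'.hom.app x₀ = _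
    rw [e]
    exact app_conj_whiskerLeft (L.anDiagram.pathFunctor r) d.hom (L.anDiagram.pathFunctor_comp r Pth)
      (L.anDiagram.pathFunctor_comp r Qth) x₀ _ _

variable (hover : ∀ {a' : (obsShape P xs).Vertex} (p q : Path a' (obsShape P xs).obs) (h : H.E p q),
  L.anOverE.IsOver ((embObs P xs hP hxs).mapPath p) ((embObs P xs hP hxs).mapPath q) (LiftPair.ofMem (D := L.anDiagram) h).hom)

/-- Bookkeeping: the path functor of a three-fold composite. [cite: MochizukiAbsTopIII2015, Definition 3.5 (i) p.75] -/
theorem pathFunctor_comp₃ {a b c d e : (anShape (Vmod := Vmod) (isArc := isArc)).Vertex} (p : Path a b) (s₁ : Path b c) (t : Path c d)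
    (u : Path d e) :
    L.anDiagram.pathFunctor (p.comp ((s₁.comp t).comp u)) =
      L.anDiagram.pathFunctor p ⋙ ((L.anDiagram.pathFunctor s₁ ⋙ L.anDiagram.pathFunctor t) ⋙ L.anDiagram.pathFunctor u) := by
  rw [pathFunctor_comp, pathFunctor_comp, pathFunctor_comp]

/-- Bookkeeping: the path functor of a two-fold composite, re-bracketed. [cite: MochizukiAbsTopIII2015, Definition 3.5 (i) p.75] -/
theorem pathFunctor_comp₂' {a b c d : (anShape (Vmod := Vmod) (isArc := isArc)).Vertex} (p : Path a b) (s₁ : Path b c) (t : Path c d) :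
    L.anDiagram.pathFunctor ((p.comp s₁).comp t) =
      L.anDiagram.pathFunctor p ⋙ (L.anDiagram.pathFunctor s₁ ⋙ L.anDiagram.pathFunctor t) := by
  rw [pathFunctor_comp, pathFunctor_comp]; rfl

/-- Bookkeeping: the path functor of `s₁.cons φ` is that of `s₁` followed by that of the one-edge path `[φ]`.
[cite: MochizukiAbsTopIII2015, Definition 3.5 (i) p.75] -/
theorem pathFunctor_cons_eq_comp_edgePath {a b c : (anShape (Vmod := Vmod) (isArc := isArc)).Vertex} (s₁ : Path a b) (j : b ⟶ c) :
    L.anDiagram.pathFunctor (s₁.cons j) = L.anDiagram.pathFunctor s₁ ⋙ L.anDiagram.pathFunctor (edgePath j) := by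
  rw [pathFunctor_cons, pathFunctor_cons, pathFunctor_nil, Functor.id_comp]

include hover in
/-- **Every member homotopy lies over `Th•[Z]`** (inner: the hypothesis on the observable, re-indexed; outer: file 3's `isOver_hom`).
[cite: MochizukiAbsTopIII2015, Remark 3.5.1 p.78] -/
theorem isOver_anSinkη (hnot : ¬ P xs) {x : (anShape (Vmod := Vmod) (isArc := isArc)).Vertex}
    {Pth Qth : Path x ((embObs P xs hP hxs).obj (obsShape P xs).obs)} (h : L.sinkE P xs hP hxs H Pth Qth) :
    L.anOverE.IsOver Pth Qth (L.sinkη P xs hP hxs H h) := by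
  obtain ⟨d⟩ := h
  rw [sinkη_eq hnot _ d]
  rcases d with ⟨w, -⟩ | d
  · exact LiftPair.isOver_hom L.anDiagram H L.anOverE hover w
  · exact d.isOver_hom hover

/-- **Push-forward INTO the observation vertex through `An•[𝒳]`**: a pair `(γ₁, γ₂)` of `D_{An•}` carrying an OVER-homotopy `θ`,
post-composed with `s = s₁ ; φ_⋏ ; u` (`s₁` into `An•[𝒳]`, `(u, u)` a member of the observable), is an OUTER member at `x` whose
homotopy is `θ ▹ D_[s]`: the heads are `γᵢ ; s₁`, and the lift of `(γ₁ ; s₁, γ₂ ; s₁)` at `An•[𝒳]` IS `θ ▹ D_[s₁]` by uniqueness of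
over-homotopies into the fully faithful `κ_{An•}⁻¹` (abc-iut-f-101's `IsOver.eq_lift`; Rmk 3.5.1).
[cite: MochizukiAbsTopIII2015, Definition 3.5 (iv) p.76] -/
theorem anSink_push_outer (hnot : ¬ P xs) {x n : (anShape (Vmod := Vmod) (isArc := isArc)).Vertex} {p q : Path x n}
    (θ : L.anDiagram.pathFunctor p ⟶ L.anDiagram.pathFunctor q) (hθ : L.anOverE.IsOver p q θ)
    (s₁ : Path n (anShape (Vmod := Vmod) (isArc := isArc)).obs) (c : DVertex Vmod isArc) (hc : P c)
    (j : (anShape (Vmod := Vmod) (isArc := isArc)).obs ⟶ (anShape (Vmod := Vmod) (isArc := isArc)).base ⟨c, hP hc⟩)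
    (u : Path ((obsShape P xs).base ⟨c, hc⟩) (obsShape P xs).obs) (hu : H.E u u)
    {s : Path n ((embObs P xs hP hxs).obj (obsShape P xs).obs)} (hs : s = (s₁.cons j).comp ((embObs P xs hP hxs).mapPath u)) :
    ∃ h : L.sinkE P xs hP hxs H (p.comp s) (q.comp s),
      L.sinkη P xs hP hxs H h = eqToHom (L.anDiagram.pathFunctor_comp p s) ≫
        Functor.whiskerRight θ (L.anDiagram.pathFunctor s) ≫ eqToHom (L.anDiagram.pathFunctor_comp q s).symm := by
  subst hs
  have hPl : p.comp ((s₁.cons j).comp ((embObs P xs hP hxs).mapPath u)) =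
      ((p.comp s₁).comp (edgePath j)).comp ((embObs P xs hP hxs).mapPath u) := by
    show p.comp ((s₁.comp (edgePath j)).comp _) = _
    simp only [Path.comp_assoc]
  have hQl : q.comp ((s₁.cons j).comp ((embObs P xs hP hxs).mapPath u)) =
      ((q.comp s₁).comp (edgePath j)).comp ((embObs P xs hP hxs).mapPath u) := by
    show q.comp ((s₁.comp (edgePath j)).comp _) = _
    simp only [Path.comp_assoc]
  let d : OuterDec L P xs hP hxs H _ _ := ⟨p.comp s₁, q.comp s₁, c, hc, j, u, u, hu, hPl, hQl⟩
  refine ⟨⟨Sum.inr d⟩, (sinkη_eq hnot _ (Sum.inr d)).trans ?_⟩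
  change d.hom = _
  -- the outer homotopy with trivial observable part is the head homotopy whiskered by `D_[u]`
  have e₁ : d.hom = eqToHom (L.anDiagram.pathFunctor_eq_of_eq_comp _ _ hPl) ≫
      Functor.whiskerRight (L.headHom (p.comp s₁) (q.comp s₁) j) (L.anDiagram.pathFunctor ((embObs P xs hP hxs).mapPath u)) ≫
      eqToHom (L.anDiagram.pathFunctor_eq_of_eq_comp _ _ hQl).symm := by
    rw [OuterDec.hom, OuterDec.tailHom]
    dsimp only [d]
    rw [OuterDec.tailHom_ofMem_self]
    exact outerShape_tail_id _ (L.anDiagram.pathFunctor_eq_of_eq_comp _ _ hPl) (L.anDiagram.pathFunctor_eq_of_eq_comp _ _ hQl)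
  -- the lift of the heads IS `θ ▹ D_[s₁]`
  have e₂ : L.anOverE.lift L.anOverE_ff_obs (p.comp s₁) (q.comp s₁) =
      eqToHom (L.anDiagram.pathFunctor_comp p s₁) ≫ Functor.whiskerRight θ (L.anDiagram.pathFunctor s₁) ≫
        eqToHom (L.anDiagram.pathFunctor_comp q s₁).symm :=
    ((hθ.whiskerRight s₁).eq_lift L.anOverE_ff_obs).symm
  rw [e₁, headHom, e₂]
  -- re-bracket: `((θ ▹ D_[s₁]) ▹ D_[φ_⋏]) ▹ D_[u] = θ ▹ D_[s₁ ; φ_⋏ ; u]`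
  have r₁ := whiskerRight_conj_whiskerRight θ (L.anDiagram.pathFunctor s₁) (L.anDiagram.pathFunctor (edgePath j))
    (L.anDiagram.pathFunctor_comp p s₁) (L.anDiagram.pathFunctor_comp q s₁) (L.anDiagram.pathFunctor_comp _ _)
    (L.anDiagram.pathFunctor_comp _ _) (L.pathFunctor_comp₂' p s₁ (edgePath j)) (L.pathFunctor_comp₂' q s₁ (edgePath j))
  rw [r₁]
  rw [whiskerRight_conj_whiskerRight θ (L.anDiagram.pathFunctor s₁ ⋙ L.anDiagram.pathFunctor (edgePath j))
    (L.anDiagram.pathFunctor ((embObs P xs hP hxs).mapPath u)) (L.pathFunctor_comp₂' p s₁ (edgePath j))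
    (L.pathFunctor_comp₂' q s₁ (edgePath j)) (L.anDiagram.pathFunctor_eq_of_eq_comp _ _ hPl)
    (L.anDiagram.pathFunctor_eq_of_eq_comp _ _ hQl) (L.pathFunctor_comp₃ p s₁ (edgePath j) _) (L.pathFunctor_comp₃ q s₁ (edgePath j) _)]
  have hs : L.anDiagram.pathFunctor ((s₁.cons j).comp ((embObs P xs hP hxs).mapPath u)) =
      (L.anDiagram.pathFunctor s₁ ⋙ L.anDiagram.pathFunctor (edgePath j)) ⋙ L.anDiagram.pathFunctor ((embObs P xs hP hxs).mapPath u) := by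
    rw [pathFunctor_comp, pathFunctor_cons_eq_comp_edgePath]
  exact whiskerRight_functor_congr θ hs.symm (L.pathFunctor_comp₃ p s₁ (edgePath j) _) (L.pathFunctor_comp₃ q s₁ (edgePath j) _)
    (L.anDiagram.pathFunctor_comp p _) (L.anDiagram.pathFunctor_comp q _)

end Sink

end LogFrobeniusSetting

end Literature.AnabelianGeometry.AbsoluteAnabelian
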